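import Literature.Barriers.FinalStateConjecture.TrappingDerivativeLossGeodesicBeams
import Literature.Barriers.FinalStateConjecture.TrappingDerivativeLossGeodesicBeamsProofs
import HarnessLib

/-!
# Discharges of named facts of `TrappingDerivativeLossBeams.lean`

`Literature/Barriers/FinalStateConjecture/TrappingDerivativeLossBeamsHolds.lean` — proofs-only
sibling of `TrappingDerivativeLossBeams.lean` (no definitions, no named facts). Each theorem
below closes a named fact `X : Prop` of that file as `X_holds : X` by composing an ACCEPTED
reduction theorem of the tree with the ACCEPTED unconditional `_holds` discharges of all of
its hypotheses; nothing is re-proved and no statement is changed. Recorded by the librarian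
sweep g25 (2026-08-16, pass 5c: facts dischargeable in one line from the tree's own lemmas),
so that the facts census, `#h21_route_deps` and the cone guardrail see these facts as
theorems.

Discharged here:

* `SbierskiKerrTrappedGeodesicBeams_holds` := `of_nullGeodesicBeams'`
  `KerrNullGeodesicGaussianBeams_holds` (`TrappingDerivativeLossGeodesicBeams.lean`).

## References

* [Sbierski2015] — see `lean/references.bib` and the docstring of the fact in `TrappingDerivativeLossBeams.lean`.
-/

namespace Literature.Barriers.FinalStateConjecture

/-- **Discharge of the named fact `SbierskiKerrTrappedGeodesicBeams`**
(`TrappingDerivativeLossBeams.lean`): Gaussian beams along a trapped null geodesic of Kerr,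
with the energy characterisation, in Sbierski's `N`-energy (named fact; the
approximate-solution input of Thm. 5.1 for the geodesics of §7A). Sbierski, Anal. PDE 8
(2015): … — obtained as `of_nullGeodesicBeams'` applied to the tree's unconditional discharge
`KerrNullGeodesicGaussianBeams_holds` of its hypothesis (reduction in
`TrappingDerivativeLossGeodesicBeams.lean`).
[cite: Sbierski2015, §4 (theorem; third remark) with §3 (second lemma; closing def.) and §7A] -/
theorem SbierskiKerrTrappedGeodesicBeams_holds :
    SbierskiKerrTrappedGeodesicBeams :=
  Literature.Barriers.FinalStateConjecture.SbierskiKerrTrappedGeodesicBeams.of_nullGeodesicBeams'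
    KerrNullGeodesicGaussianBeams_holds

end Literature.Barriers.FinalStateConjecture
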